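import Mathlib
import Literature.Computability.Complexity.CNF
import Summits.PneNP.PneNP.Theorems.OverlapGapAlgebraSearchHardWindowLipschitzRungCrux
import Summits.PneNP.PneNP.Theorems.OverlapGapAlgebraNoStableSectionGlue3
import Summits.PneNP.PneNP.Theorems.OverlapGapAlgebraNoStableSectionLadder
import Summits.PneNP.PneNP.Theorems.OverlapGapAlgebraNoStableSectionEntropy
import Summits.PneNP.PneNP.Theorems.OverlapGapAlgebraNoStableSectionCount
import Summits.PneNP.PneNP.Theorems.OverlapGapAlgebraNoStableSectionPathValid
import Summits.PneNP.PneNP.Theorems.OverlapGapAlgebraNoStableSectionIndep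
import Summits.PneNP.PneNP.Theorems.OverlapGapAlgebraNoStableSectionEnergy

/-!
# PneNP / OverlapGapAlgebra — `SearchHardWindow`: the strong Lipschitz rung, UNCONDITIONAL

Support for crux `stmt-PneNP-2460` (`Summit.PneNP.PneNP.Theses.OverlapGapAlgebra.SearchHardWindow`).
The strong Lipschitz rung (`shwLip_lipschitzMapsFail_of_noStableSection`,
`shwLip_hardnessConjunct_of_noStableSection`, file `…LipschitzRungCrux.lean`) with its only hypothesis,
the probability crux `NoStableSection` (stmt-PneNP-2462), DISCHARGED from the tree: the DartGame line of
that crux has landed its glue `Cruxes.NoStableSection.DartGame.glue_noStableSection` (six stubs ⟹ the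
crux, file `…NoStableSectionGlue3.lean`) and all six stubs (`stub_ladderExtraction`, `stub_entropyToolkit`,
`stub_condEntCount`, `stub_pathValidCount`, `stub_indepCount`, `stub_energyBound`, files
`…NoStableSection{Ladder,Entropy,Count,PathValid,Indep,Energy}.lean`); the composition is inlined here
(no theorem of type `NoStableSection` is declared — closing stmt-PneNP-2462 is its line lead's act).
* `shwLip_lipschitzMapsFail` — for all `k ≥ k₀`, every `s` with `s(n)² log³ n = o(n)` and every
  `ε > 0`: eventually in `n`, every search map on `F_k(n, ⌊5·2^k log k/k · n⌋)` that is
  `s(n)`-Lipschitz in Hamming output per single-literal change solves at most an `ε`-fraction of the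
  instances. Unconditional; no complexity hypothesis on the map.
* `shwLip_hardnessConjunct_lipschitz` — the hardness conjunct of `SearchHardWindow` at `(k, α_k)`,
  verbatim ratio shape, for every `f : List Bool → List Bool` whose decoded section is eventually
  `s(n)`-Lipschitz. Unconditional.
In words: inside the Bresler–Huang OGP window, random `k`-SAT search is impossible — success
probability `→ 0` — for the whole class of Lipschitz algorithms, proved from the ensemble multi-OGP
(all maps) + the lazy-resampling walk lemma + Efron–Stein/Chebyshev self-concentration of validity.
No new definitions; axioms `propext`, `Classical.choice`, `Quot.sound`.
-/

set_option linter.dupNamespace false -- `Summit.PneNP.PneNP.…`: summit = sub-problem (D-0017)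

namespace Summit.PneNP.PneNP.Theorems

open Finset Filter Asymptotics
open Summit.PneNP.PneNP.Cruxes.NoStableSection.DartGame
open scoped Classical

/-- **Strong Lipschitz rung, unconditional.** For all `k ≥ k₀`, every `s : ℕ → ℝ` with
`s(n)² log³ n = o(n)` and every `ε > 0`: eventually in `n`, with `m = ⌊5·2^k log k/k · n⌋`, every map
`g` from `k`-CNFs (`m` clauses, `n` variables, with-replacement literal model) to assignments that moves
at most `s n` output bits when one literal is changed solves at most `ε · #instances` instances. -/
theorem shwLip_lipschitzMapsFail :
    ∃ k₀ : ℕ, ∀ k : ℕ, k₀ ≤ k → ∀ s : ℕ → ℝ,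
      (fun n : ℕ => s n ^ 2 * Real.log n ^ 3) =o[atTop] (fun n : ℕ => (n : ℝ)) →
      ∀ ε : ℝ, 0 < ε → ∀ᶠ n : ℕ in atTop, ∀ m : ℕ, m = ⌊5 * 2 ^ k * Real.log k / k * n⌋₊ →
        ∀ g : (Fin m → Fin k → Fin n × Bool) → (Fin n → Bool),
          (∀ (Φ : Fin m → Fin k → Fin n × Bool) (a : Fin m) (b : Fin k) (ℓ : Fin n × Bool),
            (hammingDist (g Φ) (g (Function.update Φ a (Function.update (Φ a) b ℓ))) : ℝ) ≤ s n) →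
          ((Finset.univ.filter fun Φ : Fin m → Fin k → Fin n × Bool =>
              ∀ i, ∃ j, g Φ (Φ i j).1 = (Φ i j).2).card : ℝ)
            ≤ ε * Fintype.card (Fin m → Fin k → Fin n × Bool) :=
  shwLip_lipschitzMapsFail_of_noStableSection
    (glue_noStableSection stub_ladderExtraction stub_entropyToolkit stub_condEntCount
      stub_pathValidCount stub_indepCount stub_energyBound)

/-- **The hardness conjunct of `SearchHardWindow` for Lipschitz solvers, unconditional.** For all
`k ≥ k₀` and ANY `f : List Bool → List Bool` (no complexity hypothesis) whose decoded section
`Φ ↦ (v ↦ (f ⌜Φ⌝).getD v false)` on `F_k(n, ⌊α_k n⌋)`, `α_k = 5·2^k log k/k`, is eventually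
`s(n)`-Lipschitz per single-literal change with `s(n)² log³ n = o(n)`: the success ratio of `f` is
eventually `≤ ε` for every `ε > 0`. -/
theorem shwLip_hardnessConjunct_lipschitz :
    ∃ k₀ : ℕ, ∀ k : ℕ, k₀ ≤ k → ∀ (f : List Bool → List Bool) (s : ℕ → ℝ),
      (fun n : ℕ => s n ^ 2 * Real.log n ^ 3) =o[atTop] (fun n : ℕ => (n : ℝ)) →
      (∀ᶠ n : ℕ in atTop, ∀ m : ℕ, m = ⌊5 * 2 ^ k * Real.log k / k * n⌋₊ →
        ∃ g : (Fin m → Fin k → Fin n × Bool) → (Fin n → Bool),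
          (∀ (Φ : Fin m → Fin k → Fin n × Bool) (v : Fin n), g Φ v =
            (f (Literature.Computability.Complexity.encodingCNF.encode (List.ofFn fun a =>
              List.ofFn fun b => (((Φ a b).1 : ℕ), (Φ a b).2)))).getD v false) ∧
          ∀ (Φ : Fin m → Fin k → Fin n × Bool) (a : Fin m) (b : Fin k) (ℓ : Fin n × Bool),
            (hammingDist (g Φ) (g (Function.update Φ a (Function.update (Φ a) b ℓ))) : ℝ) ≤ s n) →
      ∀ ε : ℝ, 0 < ε → ∀ᶠ n : ℕ in Filter.atTop, ∀ m : ℕ, m = ⌊5 * 2 ^ k * Real.log k / k * n⌋₊ →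
        ((Finset.univ.filter fun Φ : Fin m → Fin k → Fin n × Bool => ∀ i, ∃ j,
            (f (Literature.Computability.Complexity.encodingCNF.encode (List.ofFn fun a =>
              List.ofFn fun b => (((Φ a b).1 : ℕ), (Φ a b).2)))).getD (Φ i j).1 false =
                (Φ i j).2).card : ℝ) / Fintype.card (Fin m → Fin k → Fin n × Bool) ≤ ε :=
  shwLip_hardnessConjunct_of_noStableSection
    (glue_noStableSection stub_ladderExtraction stub_entropyToolkit stub_condEntCount
      stub_pathValidCount stub_indepCount stub_energyBound)

end Summit.PneNP.PneNP.Theorems
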